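import Summits.NavierStokesRegularity.NavierStokesRegularity.Theses.PalasekTowerBreakdown
import Summits.NavierStokesRegularity.FluidComputer.PalasekTowerFaceLayerAtEnvelope

/-!
# NavierStokesRegularity — route `PalasekTowerBreakdown` (rev 19, `TowerRates.tuned`), item `HeredityAtOneT`:
# the five-face cut, the two halves and the or-breakdown form, BY NAME on the route decl

Supports `stmt-NavierStokesRegularity-20304` (`HeredityAtOneT := HeredityAtGAt TowerRates.tuned 1`, the first rung of
the re-based crux; it does NOT close it and nobody claims it). Cell `ns-blowup`, seat `ns-blowup-fc-prover-2` (g9;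
planner g23 word STATUS 2026-08-27T11:06Z (b)). LABEL: E–C typing (pure glue over the R-generic face layer
`FluidComputer/PalasekTowerFaceLayerAt{,Envelope}.lean`, by name on the route decl). WHAT THIS IS NOT: not NS — no
stage, tower or instance is constructed; the item and its faces are OPEN and appear only inside equivalences /
implications.

* `palasekTowerBreakdown_heredityAtOneT_of_faces :
  NoPrematureBreakdownGAt tuned 1 → WindowCeilingGAt tuned 1 → SpeedFloorGAt tuned 1 → StrainFloorGAt tuned 1 →
  CoreFloorGAt tuned 1 → PalasekTowerBreakdown.HeredityAtOneT` — what a five-stub birth line on 20304 registers;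
* `palasekTowerBreakdown_heredityAtOneT_iff_faces` — the cut is LOSSLESS (no hypothesis);
* `palasekTowerBreakdown_heredityAtOneT_iff_apriori_and_floors` / `_iff_envelope_and_floors` — the two registered halves
  of the wide birth line, at `tuned`;
* `palasekTowerBreakdown_heredityAtOneT_iff_orBreakdown_and_noPrematureBreakdown` — the item is its or-breakdown
  weakening plus the clause whose failure IS (C) (`navierStokesBreakdownR3_of_not_noPrematureBreakdownGAt`).

References: S. Palasek, arXiv:2605.13827 §4 [cite: Palasek2026ElementaryModel, §4]; H. Sohr, *The Navier–Stokes
Equations*, Birkhäuser 2001, Ch. V Thm. 1.5.1 [cite: Sohr2001, Ch. V Thm. 1.5.1]; J. C. Robinson, J. L. Rodrigo,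
W. Sadowski, CUP 2016, Thm. 8.17 [cite: RobinsonRodrigoSadowski2016, Thm. 8.17].
-/

-- `Summit.<Summit>.<Problem>` is the tree's mandated summit-side namespace (CONVENTIONS §2); for this
-- single-conjunct summit the two coincide, so the duplicate is deliberate.
set_option linter.dupNamespace false

namespace Summit.NavierStokesRegularity.NavierStokesRegularity.Theorems

open Summit.NavierStokesRegularity.NavierStokesRegularity.Theses
open Summit.NavierStokesRegularity.FluidComputer.PalasekTowerClayBridge

/-- **Item `HeredityAtOneT` from its five faces at `(tuned, 1)`** (the composition a five-stub birth line on
stmt-NavierStokesRegularity-20304 registers; body `heredityAtGAt_of_faces`). [cite: Palasek2026ElementaryModel, §4] -/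
theorem palasekTowerBreakdown_heredityAtOneT_of_faces
    (hN : NoPrematureBreakdownGAt TowerRates.tuned 1) (hW : WindowCeilingGAt TowerRates.tuned 1)
    (h₁ : SpeedFloorGAt TowerRates.tuned 1) (h₂ : StrainFloorGAt TowerRates.tuned 1)
    (h₃ : CoreFloorGAt TowerRates.tuned 1) :
    PalasekTowerBreakdown.HeredityAtOneT := by
  unfold PalasekTowerBreakdown.HeredityAtOneT
  exact heredityAtGAt_of_faces hN hW h₁ h₂ h₃

/-- **The five-face cut of `HeredityAtOneT` is LOSSLESS**: `HeredityAtOneT ↔ NoPrematureBreakdownGAt tuned 1 ∧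
WindowCeilingGAt tuned 1 ∧ SpeedFloorGAt tuned 1 ∧ StrainFloorGAt tuned 1 ∧ CoreFloorGAt tuned 1`.
[cite: Sohr2001, Ch. V Thm. 1.5.1] -/
theorem palasekTowerBreakdown_heredityAtOneT_iff_faces :
    PalasekTowerBreakdown.HeredityAtOneT ↔
      NoPrematureBreakdownGAt TowerRates.tuned 1 ∧ WindowCeilingGAt TowerRates.tuned 1 ∧
        SpeedFloorGAt TowerRates.tuned 1 ∧ StrainFloorGAt TowerRates.tuned 1 ∧ CoreFloorGAt TowerRates.tuned 1 := by
  unfold PalasekTowerBreakdown.HeredityAtOneT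
  exact heredityAtGAt_iff_noPrematureBreakdown_windowCeiling_floors3 1

/-- `HeredityAtOneT ↔ NoPrematureBreakdownGAt tuned 1 ∧ WindowCeilingGAt tuned 1 ∧ ReadoutFloorsGAt tuned 1` (clause ×
window ceiling × lower half). [cite: Sohr2001, Ch. V Thm. 1.5.1] -/
theorem palasekTowerBreakdown_heredityAtOneT_iff_noPrematureBreakdown_windowCeiling_readoutFloors :
    PalasekTowerBreakdown.HeredityAtOneT ↔
      NoPrematureBreakdownGAt TowerRates.tuned 1 ∧ WindowCeilingGAt TowerRates.tuned 1 ∧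
        ReadoutFloorsGAt TowerRates.tuned 1 := by
  unfold PalasekTowerBreakdown.HeredityAtOneT
  exact heredityAtGAt_iff_noPrematureBreakdown_windowCeiling_readoutFloors 1

/-- **The two halves at `tuned`**: `HeredityAtOneT ↔ AprioriCeilingGAt tuned 1 ∧ ReadoutFloorsGAt tuned 1` (no
overshoot ∧ the level-2 floors; local continuation across `τ₁` and no premature blow-up are theorems given these).
[cite: RobinsonRodrigoSadowski2016, Thm. 8.17] -/
theorem palasekTowerBreakdown_heredityAtOneT_iff_apriori_and_floors :
    PalasekTowerBreakdown.HeredityAtOneT ↔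
      AprioriCeilingGAt TowerRates.tuned 1 ∧ ReadoutFloorsGAt TowerRates.tuned 1 := by
  unfold PalasekTowerBreakdown.HeredityAtOneT
  exact heredityAtGAt_iff_apriori_and_floors le_rfl

/-- `HeredityAtOneT ↔ ContinuationEnvelopeGAt tuned 1 ∧ ReadoutFloorsGAt tuned 1` (upper half = continuation to `τ₂`
inside `(5/3)·Y₂`; lower half = the level-2 floors at `τ₂`). [cite: RobinsonRodrigoSadowski2016, Thm. 8.17] -/
theorem palasekTowerBreakdown_heredityAtOneT_iff_envelope_and_floors :
    PalasekTowerBreakdown.HeredityAtOneT ↔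
      ContinuationEnvelopeGAt TowerRates.tuned 1 ∧ ReadoutFloorsGAt TowerRates.tuned 1 := by
  unfold PalasekTowerBreakdown.HeredityAtOneT
  exact heredityAtGAt_iff_envelope_and_floors le_rfl

/-- **`HeredityAtOneT ↔ HeredityOrBreakdownGAt tuned 1 ∧ NoPrematureBreakdownGAt tuned 1`** — the item is its or-breakdown
weakening plus the clause «no registered tuned design dies inside window 1», whose failure IS Fefferman's (C)
(`navierStokesBreakdownR3_of_not_noPrematureBreakdownGAt`). [folklore] -/
theorem palasekTowerBreakdown_heredityAtOneT_iff_orBreakdown_and_noPrematureBreakdown :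
    PalasekTowerBreakdown.HeredityAtOneT ↔
      HeredityOrBreakdownGAt TowerRates.tuned 1 ∧ NoPrematureBreakdownGAt TowerRates.tuned 1 := by
  unfold PalasekTowerBreakdown.HeredityAtOneT
  exact heredityAtGAt_iff_orBreakdown_and_noPrematureBreakdown 1

/-- The or-breakdown form of the first tuned rung in faces: `HeredityOrBreakdownGAt tuned 1 ↔ WindowCeilingGAt tuned 1 ∧
SpeedFloorGAt tuned 1 ∧ StrainFloorGAt tuned 1 ∧ CoreFloorGAt tuned 1` (the clause dropped). [folklore] -/
theorem palasekTowerBreakdown_heredityOrBreakdownT_one_iff_windowCeiling_floors3 :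
    HeredityOrBreakdownGAt TowerRates.tuned 1 ↔
      WindowCeilingGAt TowerRates.tuned 1 ∧ SpeedFloorGAt TowerRates.tuned 1 ∧
        StrainFloorGAt TowerRates.tuned 1 ∧ CoreFloorGAt TowerRates.tuned 1 :=
  heredityOrBreakdownGAt_iff_windowCeiling_floors3 1

end Summit.NavierStokesRegularity.NavierStokesRegularity.Theorems
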